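import Summits.HubbardSuperconductivity.HubbardSuperconductivity.Theorems.LiebTwinDWavePolarisedDiscordanceChannelBound
import HarnessLib

/-!
# Route `LiebTwin`, crux `DWavePolarisedDiscordance` (stmt-HubbardSuperconductivity-15314), line `Sketch`:
# the leak is nonnegative (helper, `--supports`; kinematic orientation of stub `stub_leakBound`)

Line `Sketch` (card `Ideas/channel-exhaustion-sum-rule.md`) writes the `d`-wave rectification gain of a sector
vector `φ` (Lieb matrix `W = liebW n φ`, twin `|W| = CFC.abs W`) as
`D − D′ = 4m − 32·Leak − (X − X′) − 8·Exotic`, where the LEAK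
`Leak = ¼ Σ_a Re[Tr(|W|ᴴ 𝒯_a |W| 𝒯_aᵀ) − Tr(Wᴴ 𝒯_a W 𝒯_aᵀ)]`, `𝒯_a = Σ_x B_{x,x+a}` (`B_{uv} = configHop n u v`,
the rigid displacement `Σ_x c†_x c_{x+a} = Σ_k e^{ik·a} n_k`), is the zero-momentum-transfer discordance
`(L²/4) Σ_k [⟨n_{k↑}n_{−k↓}⟩_φ̃ − ⟨n_{k↑}n_{−k↓}⟩_φ]`, and the conservation law (landed
`LiebTwinChannelExhaustion.stub_channelCompleteness`, p163800) says that the total relative-channel gain is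
`Tr G = −4·Leak`. This file proves the SIGN of the leak on the class where Lieb's spectral calculus applies:

* `re_trace_mul_mul_mul_conjTranspose_le_cfcAbs` — **cone monotonicity for an arbitrary transfer matrix**:
  for Hermitian `W` and ANY `B`, `Re Tr(W B W Bᴴ) ≤ Re Tr(|W| B |W| Bᴴ)` (in the eigenbasis both sides are
  `Σ_{a,b} c_{ab} |N_{ab}|²` with `c = w_a w_b ≤ |w_a||w_b|`; the tree's `LiebSpinReflection.re_trace_unitConj_mul_le`
  is the case `Bᴴ = B`);
* `leak_nonneg_of_isHermitian`, `leak_nonneg_of_real` — for a sector vector with Hermitian Lieb matrix, and for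
  every REAL sector vector with `Wᵀ = ±W` (the class of the route's reduction `RealFlipDefiniteSuffices`; the
  antisymmetric half through `iW` Hermitian, `|iW| = |W|`), the leak is `≥ 0`: the total zero-pair-momentum
  channel weight `Σ_r ⟨Δ_rᴴΔ_r⟩` can only GROW under rectification (it is spin-reflection positive), so
  `stub_leakBound` bounds a nonnegative quantity from above and `Tr G ≤ 0`.

Sources: E. H. Lieb, PRL **62** (1989) 1201, proof of Theorem 1 (the inequality `w_i w_j ≤ |w_i||w_j|` in the
diagonal basis); G.-S. Tian, J. Phys. A **37** (2004) 2671 (review of the positivity method). Finite-dimensional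
bookkeeping; no definition and no named fact is introduced.
-/

-- the mandated namespace `Summit.<Summit>.<Problem>.Theorems` repeats `HubbardSuperconductivity`
-- (single-problem summit, D-0017), which the `dupNamespace` linter flags on every declaration
set_option linter.dupNamespace false

noncomputable section

namespace Summit.HubbardSuperconductivity.HubbardSuperconductivity.Theorems.LiebTwinChannelExhaustion

open Matrix Finset Literature.MathematicalPhysics.QuantumLattice Literature.Probability.LatticeModels
open Summit.HubbardSuperconductivity.HubbardSuperconductivity.Theorems
  (cfcAbs_eq_unitConj eq_unitConj_eigenvalues isHermitian_liebW_of_real)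
open Summit.HubbardSuperconductivity.HubbardSuperconductivity.Theorems.LiebTwinDiscordance
  (trace_unitConj_mul_mul_unitConj_mul_conjTranspose isHermitian_liebW_I_smul_of_real_antisymm)
open scoped ComplexOrder MatrixOrder Matrix.Norms.L2Operator

/-! ### Cone monotonicity for an arbitrary transfer matrix -/

section Cone

variable {A : Type*} [Fintype A] [DecidableEq A]

/-- `Re(r s (z conj z)) = r s ‖z‖²` for real `r, s`. [folklore] -/
theorem re_ofReal_mul_ofReal_mul_mul_star (r s : ℝ) (z : ℂ) :
    ((r : ℂ) * (s : ℂ) * (z * star z)).re = r * s * ‖z‖ ^ 2 := by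
  rw [Complex.star_def, Complex.mul_conj', ← Complex.ofReal_mul, ← Complex.ofReal_pow,
    ← Complex.ofReal_mul, Complex.ofReal_re]

/-- **Cone monotonicity of Lieb rectification for an arbitrary transfer matrix.** For a Hermitian `W` and
ANY matrix `B`: `Re Tr(W B W Bᴴ) ≤ Re Tr(|W| B |W| Bᴴ)`, `|W| = CFC.abs W`. In the eigenbasis `W = V D_w Vᴴ`,
`|W| = V D_{|w|} Vᴴ` both traces are `Σ_{a,b} c_{ab} |N_{ab}|²` (`N = Vᴴ B V`) with coefficients `w_a w_b`,
resp. `|w_a||w_b| ≥ w_a w_b`. Lieb, PRL 62 (1989) 1201, proof of Theorem 1. [folklore] -/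
theorem re_trace_mul_mul_mul_conjTranspose_le_cfcAbs {W : Matrix A A ℂ} (hW : W.IsHermitian)
    (B : Matrix A A ℂ) :
    ((W * B * W * Bᴴ).trace).re ≤ ((CFC.abs W * B * CFC.abs W * Bᴴ).trace).re := by
  set V : Matrix A A ℂ := (hW.eigenvectorUnitary : Matrix A A ℂ) with hV
  set f : A → ℝ := hW.eigenvalues with hf
  have hWeq : W = unitConj V f := eq_unitConj_eigenvalues hW
  have habs : CFC.abs W = unitConj V |f| := cfcAbs_eq_unitConj hW
  rw [habs]
  conv_lhs => rw [hWeq]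
  rw [trace_unitConj_mul_mul_unitConj_mul_conjTranspose, trace_unitConj_mul_mul_unitConj_mul_conjTranspose]
  simp only [Complex.re_sum, Pi.abs_apply]
  refine Finset.sum_le_sum fun a _ => Finset.sum_le_sum fun b _ => ?_
  rw [re_ofReal_mul_ofReal_mul_mul_star, re_ofReal_mul_ofReal_mul_mul_star, ← abs_mul]
  exact mul_le_mul_of_nonneg_right (le_abs_self _) (by positivity)

/-- The same with the roles of `ᴴ` made explicit on `W`: for Hermitian `W`,
`Re Tr(Wᴴ B W Bᴴ) ≤ Re Tr(|W|ᴴ B |W| Bᴴ)` (`Wᴴ = W`, `|W|ᴴ = |W|`). [folklore] -/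
theorem re_trace_conjTranspose_mul_le_cfcAbs {W : Matrix A A ℂ} (hW : W.IsHermitian) (B : Matrix A A ℂ) :
    ((Wᴴ * B * W * Bᴴ).trace).re ≤ (((CFC.abs W)ᴴ * B * CFC.abs W * Bᴴ).trace).re := by
  have hsa : (CFC.abs W)ᴴ = CFC.abs W := (CFC.abs_nonneg W).isSelfAdjoint.star_eq
  rw [hW.eq, hsa]
  exact re_trace_mul_mul_mul_conjTranspose_le_cfcAbs hW B

end Cone

/-! ### The leak of a sector vector is nonnegative (Hermitian / real flip-definite Lieb matrix) -/

section Leak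

variable {L : ℕ} [NeZero L]

/-- The rigid displacement `𝒯_a = Σ_x c†_x c_{x+a}` on `n`-subsets is a real matrix: `𝒯_aᵀ = 𝒯_aᴴ`
(both equal `𝒯_{−a}` entrywise). [folklore] -/
theorem rigidHop_transpose_eq_conjTranspose (n : ℕ) (a : TorusSite 2 L) :
    (∑ x : TorusSite 2 L, configHop n (FermionTorus.ofTorusSite x) (FermionTorus.ofTorusSite (x + a)) :
        Matrix (Config (FermionTorus 2 L) n) (Config (FermionTorus 2 L) n) ℂ)ᵀ =
      (∑ x : TorusSite 2 L, configHop n (FermionTorus.ofTorusSite x) (FermionTorus.ofTorusSite (x + a)))ᴴ := by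
  rw [Matrix.transpose_sum, Matrix.conjTranspose_sum]
  refine Finset.sum_congr rfl fun x _ => ?_
  rw [LiebTwinTwin.configHop_transpose, LiebTwinTwin.configHop_conjTranspose]

/-- **The leak is nonnegative (Hermitian Lieb matrix).** For every `n` and every Fock vector `φ` of the torus
whose Lieb matrix `W = liebW n φ` is Hermitian,
`0 ≤ Σ_a Re[Tr(|W|ᴴ 𝒯_a |W| 𝒯_aᵀ) − Tr(Wᴴ 𝒯_a W 𝒯_aᵀ)]` (`= 4·Leak`), `𝒯_a = Σ_x B_{x,x+a}`: termwise cone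
monotonicity with the transfer matrix `B = 𝒯_a` (`𝒯_aᵀ = 𝒯_aᴴ`). Equivalently `Tr G ≤ 0`: the total
zero-pair-momentum channel weight grows under rectification. Lieb, PRL 62 (1989) 1201, proof of Theorem 1. [folklore] -/
theorem leak_nonneg_of_isHermitian {n : ℕ} {φ : Fock (Orb (FermionTorus 2 L))}
    (hW : (liebW n φ).IsHermitian) :
    0 ≤ (∑ a : TorusSite 2 L,
        (((CFC.abs (liebW n φ))ᴴ *
              (∑ x : TorusSite 2 L, configHop n (FermionTorus.ofTorusSite x) (FermionTorus.ofTorusSite (x + a))) *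
              CFC.abs (liebW n φ) *
              (∑ x : TorusSite 2 L,
                configHop n (FermionTorus.ofTorusSite x) (FermionTorus.ofTorusSite (x + a)))ᵀ).trace -
          ((liebW n φ)ᴴ *
              (∑ x : TorusSite 2 L, configHop n (FermionTorus.ofTorusSite x) (FermionTorus.ofTorusSite (x + a))) *
              liebW n φ *
              (∑ x : TorusSite 2 L,
                configHop n (FermionTorus.ofTorusSite x) (FermionTorus.ofTorusSite (x + a)))ᵀ).trace)).re := by
  rw [Complex.re_sum]
  refine Finset.sum_nonneg fun a _ => ?_
  rw [Complex.sub_re, sub_nonneg, rigidHop_transpose_eq_conjTranspose]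
  exact re_trace_conjTranspose_mul_le_cfcAbs hW _

/-- The leak expression is invariant under the phase `φ ↦ iφ` (`W ↦ iW`, `|iW| = |W|`, `(iW)ᴴ 𝒯 (iW) = Wᴴ 𝒯 W`).
[folklore] -/
theorem leak_I_smul (n : ℕ) (φ : Fock (Orb (FermionTorus 2 L))) :
    (∑ a : TorusSite 2 L,
        (((CFC.abs (liebW n (Complex.I • φ)))ᴴ *
              (∑ x : TorusSite 2 L, configHop n (FermionTorus.ofTorusSite x) (FermionTorus.ofTorusSite (x + a))) *
              CFC.abs (liebW n (Complex.I • φ)) *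
              (∑ x : TorusSite 2 L,
                configHop n (FermionTorus.ofTorusSite x) (FermionTorus.ofTorusSite (x + a)))ᵀ).trace -
          ((liebW n (Complex.I • φ))ᴴ *
              (∑ x : TorusSite 2 L, configHop n (FermionTorus.ofTorusSite x) (FermionTorus.ofTorusSite (x + a))) *
              liebW n (Complex.I • φ) *
              (∑ x : TorusSite 2 L,
                configHop n (FermionTorus.ofTorusSite x) (FermionTorus.ofTorusSite (x + a)))ᵀ).trace)).re =
      (∑ a : TorusSite 2 L,
        (((CFC.abs (liebW n φ))ᴴ *
              (∑ x : TorusSite 2 L, configHop n (FermionTorus.ofTorusSite x) (FermionTorus.ofTorusSite (x + a))) *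
              CFC.abs (liebW n φ) *
              (∑ x : TorusSite 2 L,
                configHop n (FermionTorus.ofTorusSite x) (FermionTorus.ofTorusSite (x + a)))ᵀ).trace -
          ((liebW n φ)ᴴ *
              (∑ x : TorusSite 2 L, configHop n (FermionTorus.ofTorusSite x) (FermionTorus.ofTorusSite (x + a))) *
              liebW n φ *
              (∑ x : TorusSite 2 L,
                configHop n (FermionTorus.ofTorusSite x) (FermionTorus.ofTorusSite (x + a)))ᵀ).trace)).re := by
  have habs : CFC.abs (liebW n (Complex.I • φ)) = CFC.abs (liebW n φ) := by
    rw [liebW_smul, CFC.abs_smul, Complex.norm_I, one_smul]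
  have hW : ∀ T : Matrix (Config (FermionTorus 2 L) n) (Config (FermionTorus 2 L) n) ℂ,
      (liebW n (Complex.I • φ))ᴴ * T * liebW n (Complex.I • φ) = (liebW n φ)ᴴ * T * liebW n φ := by
    intro T
    rw [liebW_smul, conjTranspose_smul, Matrix.smul_mul, Matrix.smul_mul, Matrix.mul_smul, smul_smul,
      Complex.star_def, Complex.conj_I, neg_mul, Complex.I_mul_I, neg_neg, one_smul]
  simp_rw [habs, hW]

/-- **The leak is nonnegative (real flip-definite vectors)** — the class of the route's reduction
`RealFlipDefiniteSuffices`: for every REAL Fock vector `φ` of the torus with `Wᵀ = W` or `Wᵀ = −W`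
(`W = liebW n φ`), `0 ≤ Σ_a Re[Tr(|W|ᴴ 𝒯_a |W| 𝒯_aᵀ) − Tr(Wᴴ 𝒯_a W 𝒯_aᵀ)]` (`= 4·Leak`; the antisymmetric half
through `iW` Hermitian). So `stub_leakBound` of line `Sketch` bounds a NONNEGATIVE quantity on this class.
Lieb, PRL 62 (1989) 1201, proof of Theorem 1. [folklore] -/
theorem leak_nonneg_of_real {n : ℕ} {φ : Fock (Orb (FermionTorus 2 L))} (hreal : ∀ s, star (φ s) = φ s)
    (hflip : (liebW n φ)ᵀ = liebW n φ ∨ (liebW n φ)ᵀ = -liebW n φ) :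
    0 ≤ (∑ a : TorusSite 2 L,
        (((CFC.abs (liebW n φ))ᴴ *
              (∑ x : TorusSite 2 L, configHop n (FermionTorus.ofTorusSite x) (FermionTorus.ofTorusSite (x + a))) *
              CFC.abs (liebW n φ) *
              (∑ x : TorusSite 2 L,
                configHop n (FermionTorus.ofTorusSite x) (FermionTorus.ofTorusSite (x + a)))ᵀ).trace -
          ((liebW n φ)ᴴ *
              (∑ x : TorusSite 2 L, configHop n (FermionTorus.ofTorusSite x) (FermionTorus.ofTorusSite (x + a))) *
              liebW n φ *
              (∑ x : TorusSite 2 L,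
                configHop n (FermionTorus.ofTorusSite x) (FermionTorus.ofTorusSite (x + a)))ᵀ).trace)).re := by
  rcases hflip with hsym | hanti
  · exact leak_nonneg_of_isHermitian (isHermitian_liebW_of_real hreal hsym)
  · rw [← leak_I_smul n φ]
    exact leak_nonneg_of_isHermitian (isHermitian_liebW_I_smul_of_real_antisymm hreal hanti)

/-! ### The registered helper stub (route vocabulary) -/

/-- **STUB `stub_leakNonneg`** of crux `DWavePolarisedDiscordance` (stmt-HubbardSuperconductivity-15314), line `Sketch`:
on every torus, for every real Fock vector with flip-definite Lieb matrix (`Wᵀ = ±W`), the leak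
`Σ_a Re[Tr(|W|ᴴ 𝒯_a |W| 𝒯_aᵀ) − Tr(Wᴴ 𝒯_a W 𝒯_aᵀ)]` is nonnegative — the kinematic orientation of `stub_leakBound`
(which bounds it from above by `η·m + εL⁴` along ground states). Lieb, PRL 62 (1989) 1201, proof of Theorem 1. [folklore] -/
theorem stub_leakNonneg :
    open Literature.MathematicalPhysics.QuantumLattice Literature.Probability.LatticeModels in open scoped MatrixOrder Matrix.Norms.L2Operator in ∀ (L : ℕ) [NeZero L] (n : ℕ) (φ : Fock (Orb (FermionTorus 2 L))), (∀ s, star (φ s) = φ s) → ((liebW n φ)ᵀ = liebW n φ ∨ (liebW n φ)ᵀ = -liebW n φ) → 0 ≤ (∑ a : TorusSite 2 L, (((CFC.abs (liebW n φ))ᴴ * (∑ x : TorusSite 2 L, configHop n (FermionTorus.ofTorusSite x) (FermionTorus.ofTorusSite (x + a))) * CFC.abs (liebW n φ) * (∑ x : TorusSite 2 L, configHop n (FermionTorus.ofTorusSite x) (FermionTorus.ofTorusSite (x + a)))ᵀ).trace - ((liebW n φ)ᴴ * (∑ x : TorusSite 2 L, configHop n (FermionTorus.ofTorusSite x) (FermionTorus.ofTorusSite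 (x + a))) * liebW n φ * (∑ x : TorusSite 2 L, configHop n (FermionTorus.ofTorusSite x) (FermionTorus.ofTorusSite (x + a)))ᵀ).trace)).re :=
  fun _ _ _ _ hreal hflip => leak_nonneg_of_real hreal hflip

end Leak

end Summit.HubbardSuperconductivity.HubbardSuperconductivity.Theorems.LiebTwinChannelExhaustion

end
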